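import Summits.CriticalPhenomena.PercolationContinuityZ3.Theorems.PercNearOneGluingNoHeavyLowerTailFKHullPortTASToolsS
import Summits.CriticalPhenomena.PercolationContinuityZ3.Theorems.PercNearOneGluingNoHeavyLowerTailFKHullPortDeltaNBase
import HarnessLib

/-!
# FK sub-lane: rigid states for the owner-set `T^S` functionals of `φ_{𝐩,q}` (vdBHK Lemma 2.3 factorisation)

Support file (`--supports stmt-CriticalPhenomena-4575`), FK sub-lane `prim-bschramm-fk-2` (gen 3); builds on p205010 (kernel theorem,
internal audit signed; external expert review pending).  No definitions, no named facts, no sorries; standard axioms.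

The owner-set copies of the rigid-state closed forms of `…FKHullPortRigid.lean` / `…FKHullPortTAInduction.lean` (this cell): if every
pair touching the avoided set `X` has parameter `0` or `1` (weight-one pairs inside `X`), the cluster of `X` is sure,
`Σ_ω w_q(ω) G(ω ∖ B_X) = Z·E_{φ_{G−B_X,q}}[G]` (`FK.sum_rigid_factor`), and `B^S, b^S, a^S, A^S, B^S_{X∪{b}}` are `Z` times world
quantities of `H = G − B_X`; hence `Q^S = 0` in a rigid state (base of the `T^S` induction) and `φ_H(y ↮ S) > 0`.
bschramm/FK-Q2.md §12.6(c). [cite: VandenbergHaggstromKahn2005, §2.1 Lemma 2.3 (p. 10)] [cite: Grimmett2006, §1.4 eq. (1.20), Thm. (3.1)]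
-/

noncomputable section

namespace Summit.CriticalPhenomena.PercolationContinuityZ3.Theorems.FK

open MeasureTheory Set Literature.Probability.LatticeModels Literature.Probability.Percolation
open Literature.Probability.Percolation.DecisionTree (ind ind_of_mem ind_of_not_mem ind_nonneg)
open Literature.Probability.Percolation.BHK2006 (rcMass delW)
open Summit.CriticalPhenomena.PercolationContinuityZ3.Theorems.HullPort (cut avoidEv connS)
open scoped Classical

variable {V : Type*} [Fintype V]

section RigidS

open Literature.Probability.Percolation.BHK2006 (weight rcMass_nonneg coe_delW setCl barOf mem_setCl_iff mem_barOf_iff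
  rc_sum_setCl_eq sum_rcMass)
open Summit.CriticalPhenomena.PercolationContinuityZ3.Theorems.HullPort (insert_mem_avoidEv_iff cut_insert_edge edge_mem_cut
  eq_of_reachable_of_isolated mem_cut_of_mem cut_insert_vertex cut_empty mem_of_reachable_of_noBoundary
  not_mem_of_reachable_of_noBoundary cut_eq_of_noBoundary reachable_sdiff_iff_of_noBoundary sum_weight_resample
  avoidEv_insert_insert_eq ind_inter_compl)

/-- `φ_H(y ↮ S) > 0` (`y ∉ S`) for a weight vector with no weight-`1` pair (the empty configuration isolates `y`).
[cite: Grimmett2006, Thm. (3.1) eq. (3.4) (finite energy)] -/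
theorem wE_compl_connS_pos (u : Sym2 V → unitInterval) {q : ℝ} (hq : 0 < q) {S : Set V} {y : V} (hyS : y ∉ S)
    (hu : ∀ p : Sym2 V, ((u p : unitInterval) : ℝ) ≠ 1) : 0 < wE u q ∅ (ind (connS S y : Set (Set (Sym2 V)))ᶜ) := by
  classical
  unfold wE
  have hterm : ∀ η, 0 ≤ rcMass (delW u ∅) q η * ind (connS S y : Set (Set (Sym2 V)))ᶜ η := fun η =>
    mul_nonneg (rcMass_nonneg _ hq η) (ind_nonneg _ _)
  refine lt_of_lt_of_le ?_ (Finset.single_le_sum (fun η _ => hterm η) (Finset.mem_univ (∅ : BondConfig V)))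
  have hmem : (∅ : BondConfig V) ∈ (connS S y : Set (Set (Sym2 V)))ᶜ := fun ⟨u, hu, h⟩ =>
    hyS ((eq_of_reachable_of_isolated (fun e he => (Set.notMem_empty e he).elim) u h) ▸ hu)
  rw [ind_of_mem hmem, mul_one, delW_empty]
  unfold rcMass
  refine div_pos ?_ (rcPartitionFunctionW_pos u hq ∅)
  unfold rcWeightW weight
  refine mul_pos (Finset.prod_pos fun e _ => ?_) (pow_pos hq _)
  rw [if_neg (Set.notMem_empty e)]
  exact sub_pos.2 (lt_of_le_of_ne (u e).2.2 (hu e))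

/-! ### The functionals in a rigid state -/

/-- In a rigid state (owner `x ∉ X`), `B^S(w, X) = Z · c^S_H`, `c_H` the covariance in the world `G − B_X`.
[cite: VandenbergHaggstromKahn2005, §2.1 Lemma 2.3 (p. 10)] -/
theorem taBS_rigid (w : Sym2 V → unitInterval) (q : ℝ) {X : Set V} {x : V} (S : Set V) (y : V) (hsX : x ∉ X)
    (hR : ∀ p : Sym2 V, ¬ p.IsDiag → (∃ u ∈ p, u ∈ X) → ((w p : unitInterval) : ℝ) = 0 ∨ ((w p : unitInterval) : ℝ) = 1)
    (hINV : ∀ p : Sym2 V, ((w p : unitInterval) : ℝ) = 1 → ∀ u ∈ p, u ∈ X) (g : Set (Sym2 V) → ℝ) :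
    taBS w q x S y X g = rcPartitionFunctionW w q ∅ *
      (wE w q {p : Sym2 V | ∃ u ∈ p, u ∈ X} (fun η => g (openEdgeCluster η x) * ind (connS S y) η) -
        wE w q {p : Sym2 V | ∃ u ∈ p, u ∈ X} (fun η => g (openEdgeCluster η x)) *
          wE w q {p : Sym2 V | ∃ u ∈ p, u ∈ X} (ind (connS S y))) := by
  unfold taBS rcPartitionFunctionW
  rw [Finset.sum_mul]
  refine Finset.sum_congr rfl fun ω _ => ?_
  by_cases hne : rcWeightW w q ∅ ω = 0
  · rw [hne, zero_mul, zero_mul]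
  · have hζ := noBoundary_of_ne_zero (q := q) hR hINV hne
    have hcut : cut X ω = {p : Sym2 V | ∃ u ∈ p, u ∈ X} := cut_eq_of_noBoundary hζ
    have hav : ω ∈ avoidEv x X := fun t ht hst => (not_mem_of_reachable_of_noBoundary hζ hsX hst) ht
    rw [ind_of_mem hav, one_mul]
    unfold taCS
    rw [hcut]

/-- In a rigid state (`y ∉ X`), `b^S(w, X) = Z · φ_{G − B_X}(y ↮ S)`. [cite: VandenbergHaggstromKahn2005, §2.1 Lemma 2.3 (p. 10)] -/
theorem tabS_rigid (w : Sym2 V → unitInterval) {q : ℝ} (hq : 0 < q) {X : Set V} (S : Set V) {y : V} (hyX : y ∉ X)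
    (hR : ∀ p : Sym2 V, ¬ p.IsDiag → (∃ u ∈ p, u ∈ X) → ((w p : unitInterval) : ℝ) = 0 ∨ ((w p : unitInterval) : ℝ) = 1)
    (hINV : ∀ p : Sym2 V, ((w p : unitInterval) : ℝ) = 1 → ∀ u ∈ p, u ∈ X) :
    tabS w q S y X = rcPartitionFunctionW w q ∅ * wE w q {p : Sym2 V | ∃ u ∈ p, u ∈ X} (ind (connS S y : Set (Set (Sym2 V)))ᶜ) := by
  rw [← sum_rigid_factor w hq hR hINV]
  unfold tabS
  refine Finset.sum_congr rfl fun ω _ => ?_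
  by_cases hne : rcWeightW w q ∅ ω = 0
  · rw [hne, zero_mul, zero_mul]
  · have hζ := noBoundary_of_ne_zero (q := q) hR hINV hne
    congr 1
    have hiff : ω ∈ avoidEv y (S ∪ X) ↔ ω \ {p : Sym2 V | ∃ u ∈ p, u ∈ X} ∈ (connS S y : Set (Set (Sym2 V)))ᶜ := by
      constructor
      · rintro h ⟨u, hu, hyu⟩
        exact h u (Set.mem_union_left _ hu) ((reachable_sdiff_iff_of_noBoundary hζ hyX u).1 hyu)
      · intro h t ht hyt
        rcases ht with htS | htX
        · exact h ⟨t, htS, (reachable_sdiff_iff_of_noBoundary hζ hyX t).2 hyt⟩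
        · exact (not_mem_of_reachable_of_noBoundary hζ hyX hyt) htX
    by_cases h : ω ∈ avoidEv y (S ∪ X)
    · rw [ind_of_mem h, ind_of_mem (hiff.1 h)]
    · rw [ind_of_not_mem h, ind_of_not_mem (fun h' => h (hiff.2 h'))]

/-- In a rigid state (`y ∉ X`), `a^S(w, X) = Z · φ_{G − B_X}(y ↮ S, y ↔ z)`. [cite: VandenbergHaggstromKahn2005, §2.1 Lemma 2.3 (p. 10)] -/
theorem taaS_rigid (w : Sym2 V → unitInterval) {q : ℝ} (hq : 0 < q) {X : Set V} (S : Set V) {y z : V} (hyX : y ∉ X)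
    (hR : ∀ p : Sym2 V, ¬ p.IsDiag → (∃ u ∈ p, u ∈ X) → ((w p : unitInterval) : ℝ) = 0 ∨ ((w p : unitInterval) : ℝ) = 1)
    (hINV : ∀ p : Sym2 V, ((w p : unitInterval) : ℝ) = 1 → ∀ u ∈ p, u ∈ X) :
    taaS w q S y z X = rcPartitionFunctionW w q ∅ *
      wE w q {p : Sym2 V | ∃ u ∈ p, u ∈ X} (ind ((connS S y : Set (Set (Sym2 V)))ᶜ ∩ openConn y z)) := by
  rw [← sum_rigid_factor w hq hR hINV]
  unfold taaS
  refine Finset.sum_congr rfl fun ω _ => ?_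
  by_cases hne : rcWeightW w q ∅ ω = 0
  · rw [hne, zero_mul, zero_mul]
  · have hζ := noBoundary_of_ne_zero (q := q) hR hINV hne
    congr 1
    have hiff : ω ∈ avoidEv y (S ∪ X) ∩ openConn y z ↔
        ω \ {p : Sym2 V | ∃ u ∈ p, u ∈ X} ∈ (connS S y : Set (Set (Sym2 V)))ᶜ ∩ openConn y z := by
      constructor
      · rintro ⟨h, hyz⟩
        refine ⟨fun ⟨u, hu, hyu⟩ => h u (Set.mem_union_left _ hu) ((reachable_sdiff_iff_of_noBoundary hζ hyX u).1 hyu), ?_⟩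
        exact (reachable_sdiff_iff_of_noBoundary hζ hyX z).2 hyz
      · rintro ⟨h, hyz⟩
        refine ⟨fun t ht hyt => ?_, (reachable_sdiff_iff_of_noBoundary hζ hyX z).1 hyz⟩
        rcases ht with htS | htX
        · exact h ⟨t, htS, (reachable_sdiff_iff_of_noBoundary hζ hyX t).2 hyt⟩
        · exact (not_mem_of_reachable_of_noBoundary hζ hyX hyt) htX
    by_cases h : ω ∈ avoidEv y (S ∪ X) ∩ openConn y z
    · rw [ind_of_mem h, ind_of_mem (hiff.1 h)]
    · rw [ind_of_not_mem h, ind_of_not_mem (fun h' => h (hiff.2 h'))]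

/-- In a rigid state, with `b ∉ X` and `s ∉ X`: `B^S(w, X ∪ {b}) = Z · E_{φ_H}[1{x ↮ b} c^S(H − cut_b)]` for the world `H = G − B_X`, i.e.
`Z · B^S(w_H, {b}) / Z_H`. [cite: VandenbergHaggstromKahn2005, §2.1 Lemma 2.3 (p. 10)] -/
theorem taBS_insert_rigid (w : Sym2 V → unitInterval) {q : ℝ} (hq : 0 < q) {X : Set V} {x b : V} (S : Set V) (y : V)
    (hsX : x ∉ X)
    (hbX : b ∉ X)
    (hR : ∀ p : Sym2 V, ¬ p.IsDiag → (∃ u ∈ p, u ∈ X) → ((w p : unitInterval) : ℝ) = 0 ∨ ((w p : unitInterval) : ℝ) = 1)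
    (hINV : ∀ p : Sym2 V, ((w p : unitInterval) : ℝ) = 1 → ∀ u ∈ p, u ∈ X) (g : Set (Sym2 V) → ℝ) :
    taBS w q x S y (insert b X) g = rcPartitionFunctionW w q ∅ *
      wE w q {p : Sym2 V | ∃ u ∈ p, u ∈ X}
        (fun η => ind (avoidEv x {b}) η * taCS (delW w {p : Sym2 V | ∃ u ∈ p, u ∈ X}) q x S y {b} g η) := by
  rw [← sum_rigid_factor w hq hR hINV]
  unfold taBS
  refine Finset.sum_congr rfl fun ω _ => ?_
  by_cases hne : rcWeightW w q ∅ ω = 0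
  · rw [hne, zero_mul, zero_mul]
  · have hζ := noBoundary_of_ne_zero (q := q) hR hINV hne
    set B : Set (Sym2 V) := {p : Sym2 V | ∃ u ∈ p, u ∈ X} with hB
    have hcutX : cut X ω = B := cut_eq_of_noBoundary hζ
    congr 1
    have hav : ind (avoidEv x (insert b X)) ω = ind (avoidEv x {b}) (ω \ B) := by
      have hiff : ω ∈ avoidEv x (insert b X) ↔ ω \ B ∈ avoidEv x {b} := by
        constructor
        · intro h t ht hst
          rw [Set.mem_singleton_iff] at ht; subst ht
          exact h t (Set.mem_insert _ _) ((reachable_sdiff_iff_of_noBoundary hζ hsX t).1 hst)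
        · intro h t ht hst
          rcases Set.mem_insert_iff.1 ht with rfl | htX
          · exact h t (Set.mem_singleton _) ((reachable_sdiff_iff_of_noBoundary hζ hsX t).2 hst)
          · exact (not_mem_of_reachable_of_noBoundary hζ hsX hst) htX
      by_cases h : ω ∈ avoidEv x (insert b X)
      · rw [ind_of_mem h, ind_of_mem (hiff.1 h)]
      · rw [ind_of_not_mem h, ind_of_not_mem (fun h' => h (hiff.2 h'))]
    have hC : taCS w q x S y (insert b X) g ω = taCS (delW w B) q x S y {b} g (ω \ B) := by
      unfold taCS wE
      rw [cut_insert_vertex X b ω, hcutX, delW_delW]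
    rw [hav, hC]

/-- In a rigid state (`x ∉ X`), `A^S(w, X; z) = Z · (a_H/b_H) · c^S_H` with the world quantities of `H = G − B_X`.
[cite: VandenbergHaggstromKahn2005, §2.1 Lemma 2.3 (p. 10)] -/
theorem taAS_rigid (w : Sym2 V → unitInterval) (q : ℝ) {X : Set V} {x : V} (S : Set V) (y z : V) (hsX : x ∉ X)
    (hR : ∀ p : Sym2 V, ¬ p.IsDiag → (∃ u ∈ p, u ∈ X) → ((w p : unitInterval) : ℝ) = 0 ∨ ((w p : unitInterval) : ℝ) = 1)
    (hINV : ∀ p : Sym2 V, ((w p : unitInterval) : ℝ) = 1 → ∀ u ∈ p, u ∈ X) (g : Set (Sym2 V) → ℝ) :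
    taAS w q x S y z X g = rcPartitionFunctionW w q ∅ *
      (wE w q {p : Sym2 V | ∃ u ∈ p, u ∈ X} (ind ((connS S y : Set (Set (Sym2 V)))ᶜ ∩ openConn y z)) /
          wE w q {p : Sym2 V | ∃ u ∈ p, u ∈ X} (ind (connS S y : Set (Set (Sym2 V)))ᶜ) *
        (wE w q {p : Sym2 V | ∃ u ∈ p, u ∈ X} (fun η => g (openEdgeCluster η x) * ind (connS S y) η) -
          wE w q {p : Sym2 V | ∃ u ∈ p, u ∈ X} (fun η => g (openEdgeCluster η x)) *
            wE w q {p : Sym2 V | ∃ u ∈ p, u ∈ X} (ind (connS S y)))) := by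
  unfold taAS rcPartitionFunctionW
  rw [Finset.sum_mul]
  refine Finset.sum_congr rfl fun ω _ => ?_
  by_cases hne : rcWeightW w q ∅ ω = 0
  · rw [hne, zero_mul, zero_mul]
  · have hζ := noBoundary_of_ne_zero (q := q) hR hINV hne
    have hcut : cut X ω = {p : Sym2 V | ∃ u ∈ p, u ∈ X} := cut_eq_of_noBoundary hζ
    have hav : ω ∈ avoidEv x X := fun t ht hst => (not_mem_of_reachable_of_noBoundary hζ hsX hst) ht
    rw [ind_of_mem hav, one_mul]
    unfold taCS taNS taNWS
    rw [hcut]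

/-- In a rigid state (`x, y ∉ X`, `y ∉ S`), `Q^S = A·b − a·B = 0`: the base case of the `T^S` induction for `φ_{𝐩,q}`.
[cite: VandenbergHaggstromKahn2005, §2.1 Lemma 2.3 (p. 10)] -/
theorem taQS_rigid_eq_zero (w : Sym2 V → unitInterval) {q : ℝ} (hq : 0 < q) {X : Set V} {x : V} {S : Set V} {y : V} (z : V)
    (hyS : y ∉ S) (hsX : x ∉ X) (hyX : y ∉ X)
    (hR : ∀ p : Sym2 V, ¬ p.IsDiag → (∃ u ∈ p, u ∈ X) → ((w p : unitInterval) : ℝ) = 0 ∨ ((w p : unitInterval) : ℝ) = 1)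
    (hINV : ∀ p : Sym2 V, ((w p : unitInterval) : ℝ) = 1 → ∀ u ∈ p, u ∈ X) (g : Set (Sym2 V) → ℝ) :
    taQS w q x S y z X g = 0 := by
  unfold taQS
  rw [taAS_rigid w q S y z hsX hR hINV g, taBS_rigid w q S y hsX hR hINV g, tabS_rigid w hq S hyX hR hINV,
    taaS_rigid w hq S hyX hR hINV]
  set B : Set (Sym2 V) := {p : Sym2 V | ∃ u ∈ p, u ∈ X} with hB
  have hn0 : 0 < wE w q B (ind (connS S y : Set (Set (Sym2 V)))ᶜ) := by
    rw [← wE_delW_empty]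
    refine wE_compl_connS_pos (delW w B) hq hyS fun p hp1 => ?_
    by_cases hpB : p ∈ B
    · rw [coe_delW, if_pos hpB] at hp1; exact zero_ne_one hp1
    · rw [coe_delW, if_neg hpB] at hp1
      apply hpB
      induction p using Sym2.ind with
      | h u' v' => exact ⟨u', Sym2.mem_mk_left _ _, hINV _ hp1 u' (Sym2.mem_mk_left _ _)⟩
  field_simp
  ring

end RigidS

end Summit.CriticalPhenomena.PercolationContinuityZ3.Theorems.FK

end
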